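import Summits.Langlands.Langlands.Theorems.PhantomRMYoshidaResiduallyYoshidaLiftingCrossRegularDefs
import Summits.Langlands.Langlands.Theorems.PhantomRMYoshidaResiduallyYoshidaLiftingCrossRegularSupply
import Summits.Langlands.Langlands.Theorems.PhantomRMYoshidaResiduallyYoshidaLiftingLimitAtFixedLevel
import Summits.Langlands.Langlands.Theorems.PhantomRMYoshidaResiduallyYoshidaLiftingTraceCatalogueOfFrob
import Summits.Langlands.Langlands.Theorems.PhantomRMYoshidaResiduallyYoshidaLiftingTraceCatalogueOfFiniteCuspidal
import Summits.Langlands.Langlands.Theorems.PhantomRMYoshidaResiduallyYoshidaLiftingCrossLevelRaisingSeedParts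
import HarnessLib



/-!
# `ResiduallyYoshidaLifting` (stmt-Langlands-13639, route PhantomRMYoshida) — line `cross-regular-annihilator-primes`
# LEAD SKELETON (prover-line-stmt-Langlands-13639-2, rev 3, 2026-08-16: S5b landed p99507, S5c = p99281 + glue + S5c′ `stub_finiteCuspidalSpectrum`; S3 parts p99404)
# rev 2, 2026-08-16: S2 landed p97490 and imported; S5 reshaped into S5a/S5b/S5c)
# rev 1: currency re-homed to the Theorems-side
# namespace `…CrossRegularAnnihilatorPrimes`; S4 reshaped (seed level first, Disproof T6b); S0 `stub_cruxUnfold` added.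

Crux (fixed, by name): `Summit.Langlands.Langlands.Theses.PhantomRMYoshida.ResiduallyYoshidaLifting` — relative
automorphy lifting at a residually-Yoshida point in weight (2,2): `p` odd; `σ̄, σ̄' : Γ_ℚ → GL₂(k)` odd,
irreducible, non-conjugate, `det = ε̄⁻¹`; `ρ₀, ρ : Γ_ℚ → GL₄(ℚ̄_p)` irreducible, symplectic-`ε⁻¹`,
Greenberg-ordinary `(0,0,1,1)`, `p`-distinguished, residually `σ̄ ⊕ σ̄'`; `Aut ρ₀ → Aut ρ`.

Line (idea card `Ideas/cross-regular-annihilator-primes.md`; triage r1-1/2/3: pass, merged with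
`conjugation-steinberg-primes`): KHARE–THORNE SUCCESSIVE APPROXIMATION WITH CROSS-REGULAR AUXILIARY PRIMES.
The Taylor–Wiles-invisible dual-Selmer block `H¹(ℚ, M(1))`, `M = Hom(σ̄', σ̄)`, is killed by auxiliary primes
`v` at which `ρ̄(Frob_v)` has four distinct eigenvalues `{ā, q̄b̄ | q̄ā, b̄}` with ONE cross ratio `q̄ = q_v`
between the residual constituents (symplecticity forces the second), where the square-zero pure-cross
monodromy defines a smooth, Euler-characteristic-NEUTRAL local condition `𝒟_v^×`. `ρ` is unramified at such
`v`, but `ρ mod p^N` satisfies the condition as soon as `charpoly ρ(Frob_v) ≡ (X−a)(X−q_v a)(X−b)(X−q_v b)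
(mod p^N)`, available at every depth `N` by Chebotarev from ONE exact cross-regular element of `im ρ`
(S1 → S2). Then S3 (level-raising seed from the GIVEN automorphic `ρ₀`) → S4 (integral `R_𝒮(N) = T_𝒮(N)`:
`ρ mod p^N` is Hecke-span congruent to ×-new stable weight-2 forms of level `𝔫₁·Kl(Q_N)`) → S5 (Mazur's
principle mod `p^N` at the auxiliary primes + the limit `N → ∞` at the fixed level `𝔫₁`; Thorne2016
Cor. 4.15) → `Aut ρ`.

Typing policy. The tree has no deformation rings, Selmer groups, Hecke algebras or Siegel modular forms; every
stub is stated at the Galois / `GL₄`-automorphic interface over existing declarations, through the definitions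
of the currency module `CrossRegularCurrency.lean` (same directory; definitions only, no sorry):
`Sh`, `Aut`, `DetCond` (verbatim the crux's inline clauses), `ExactCross`, `QGood`, `QGoodRes`, `CrossType`,
`Member`, `HSC`, `CrossFamily`. Stub signatures are therefore short, `:=`-free and self-contained given
`import Summits.Langlands.Langlands.Cruxes.ResiduallyYoshidaLifting.CrossRegularCurrency` (+ `open scoped
Classical`).

Disproof used (body of `Disproof.lean` not mounted in planner/refuter jails this round; from its evidence
notes): `iff_withoutOdd` — oddness is decoration: no stub takes `σ.IsOdd`; `not_withoutIrreducibleρ_of_witness`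
— `ρ.toGaloisRep.IsIrreducible` is a hypothesis of S1, S4, S5 and is load-bearing in S4 (for `ρ_f ⊕ ρ_g` the
chain S2–S5 would contradict Jacquet–Shalika); `shC_iff_without_residual_unramified` — harmless;
`trace_complexConjugation_eq_zero` — `c` is a DEGENERATE cross element, whence S1 asks for a regular one
(the card's dead variant (α); triage r1-2's kill of the IVa-at-c variant); `iff_congruenceLifting` — the
stubs are indeed a congruence-lifting chain. No `Negative/` lemma has landed for this crux.

References: J. Thorne, *Automorphy of some residually dihedral Galois representations*, Math. Ann. 364 (2016)
[Thorne2016: §1 pp. 3–4, Thm. 4.14, Cor. 4.15, Prop. 4.16, Cor. 5.11, §5.4.4, Lemma 5.18, Prop. 5.20,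
Lemma 5.23]; G. Boxer, F. Calegari, T. Gee, V. Pilloni [BoxerEtAl2021 §7]; F. Calegari, D. Geraghty
[CalegariGeraghty2017]; C. Sorensen [Sorensen2006]; H. Wang [WangHaining2022LevelRaising]; P. van Hoften,
arXiv:1906.04008; T. Gee, O. Taïbi [GeeTaibi2019]; M. Kisin [Kisin2009]; A. Borel, H. Jacquet
[BorelJacquet1979, 4.3 (i), 4.6].
-/

noncomputable section

set_option linter.dupNamespace false

open scoped Matrix Classical
open Filter Set Function

-- `open scoped Classical` is REQUIRED (see the currency module).

namespace Summit.Langlands.Langlands.Cruxes.ResiduallyYoshidaLifting.CrossRegularAnnihilatorPrimes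

/-! ## Stubs of the line (registered on stmt-Langlands-13639) -/

/-- STUB S1 — COVERAGE STUB (exact cross-regular element, `Summit.Langlands.Langlands.Cruxes.ResiduallyYoshidaLifting.CrossRegularAnnihilatorPrimes.ExactCross`). For the crux data —
`σ̄, σ̄'` irreducible, non-conjugate, `det = ε̄⁻¹`, and `ρ` irreducible of shape `Sh` (symplectic-`ε⁻¹`,
Greenberg `(0,0,1,1)`, residually `σ̄ ⊕ σ̄'`) — there is `γ ∈ Γ_ℚ` at which `ρ(γ)` is EXACTLY ×-shaped,
`charpoly ρ(γ) = (X−a)(X−ea)(X−b)(X−eb)`, `e = ε_p(γ)`, `e²ab = 1`, in CROSS position residually (`ā, ē b̄` are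
the eigenvalues of `σ̄(γ)`, `ē ā, b̄` those of `σ̄'(γ)`) and residually GENERIC. Seed: complex conjugation
`c` is an exact but DEGENERATE cross element of every odd symplectic `ρ` (Disproof
`trace_complexConjugation_eq_zero`: tr ρ(c) = 0); for `im ρ ⊇ Γ(p)` a residual cross-regular generic class
Hensel-lifts to an exact one along the block-diagonal torus (one equation `ν b' = a`, transversal).
EXPECTED TO FAIL exactly on the sub-sector no surviving line covers: `p = 3` phantom-RM pairs have no
cross-regular residual class at all (triage r1-1, `cross_regular.py`, exhaustive), and very small / deep
images may obstruct the Hensel step. This is precisely the hypothesis the route planner is asked to add to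
the crux (triage r1-1/2/3 "sharpen"); once added, S1 is discharged by `id` and the line has four stubs.
[cite: Thorne2016, Prop. 5.20 and Lemma 5.23 (c ∈ G_K replaced by a regular exact cross element σ_×)] -/
theorem stub_exactCrossElement :
    ∀ (p : ℕ) [Fact p.Prime], p ≠ 2 → ∀ (k : Type) [Field k] [CharP k p] [IsAlgClosed k] [TopologicalSpace k] [DiscreteTopology k] (red : Valued.integer (PadicAlgCl p) →+* k) (σ σ' : Literature.NumberTheory.GaloisRepresentations.FramedGaloisRep ℚ k 2) (hcpt : Literature.NumberTheory.Automorphic.isCompact_glFiniteIntegralLevel 4 ℚ) (ι : PadicAlgCl p ≃+* ℂ) (ρ : Literature.NumberTheory.GaloisRepresentations.FramedGaloisRep ℚ (PadicAlgCl p) 4), σ.toGaloisRep.IsIrreducible → σ'.toGaloisRep.IsIrreducible → Summit.Langlands.Langlands.Cruxes.ResiduallyYoshidaLifting.CrossRegularAnnihilatorPrimes.DetCond p σ σ' → (¬ ∃ g : GL (Fin 2) k, ∀ x, g * σ x * g⁻¹ = σ' x) → ρ.toGaloisRep.IsIrreducible → Summit.Langlands.Langlands.Cruxes.ResiduallyYoshidaLifting.CrossRegularAnnihilatorPrimes.Sh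 σ σ' red ρ → Summit.Langlands.Langlands.Cruxes.ResiduallyYoshidaLifting.CrossRegularAnnihilatorPrimes.ExactCross σ σ' red ρ := by
  sorry

-- STUB S2 `stub_crossRegularSupply` LANDED (p97490, Theorems/PhantomRMYoshidaResiduallyYoshidaLiftingCrossRegularSupply.lean) and is imported.

/-- STUB S3 (level-raising seed: a STABLE weight-2 automorphic point of ×-type at the auxiliary primes). From the
automorphic, irreducible `ρ₀` of shape `Sh` (the crux's relative hypothesis — used here and only here): there
are a base level `𝔫₀ ≠ 0` and an infinity type `T₀` such that for every finite set `Q` of places `v ∤ p𝔫₀` at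
which `ρ₀` is unramified and `σ̄ ⊕ σ̄'` is cross-regular generic (`Summit.Langlands.Langlands.Cruxes.ResiduallyYoshidaLifting.CrossRegularAnnihilatorPrimes.QGoodRes`), there is a cuspidal
L-algebraic `π₁` of `GL₄(𝔸_ℚ)` with a `K(𝔫₀·∏_Q v²)`-fixed vector and infinity type `T₀`, whose Galois
representation `ρ₁` is irreducible, of shape `Sh`, and of ×-TYPE at each `v ∈ Q` (`Summit.Langlands.Langlands.Cruxes.ResiduallyYoshidaLifting.CrossRegularAnnihilatorPrimes.CrossType`:
`(ρ₁(τ) − 1)² = 0` on inertia, exact Frobenius shape `(X−a)(X−q_v a)(X−b)(X−q_v b)`, `q_v² ab = 1`; on GSp₄: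
Klingen-new of Roberts–Schmidt type IIIa). `Q = ∅` is `ρ₀` itself with its level and infinity type. Engine:
level raising for GSp₄ at a CROSS level-raising congruence (Sorensen2006 / WangHaining2022LevelRaising in
regular weight; weight (2,2) through the ordinary family + BoxerEtAl2021 classicality), GeeTaibi2019
transfer. OPEN in weight 2 (triage r1-2 (iii)); stable → stable, NOT the endoscopic → stable raising of crux 3.
[cite: Sorensen2006, Thm. A] [cite: Thorne2016, §4.8 (the level-raising step of the Khare–Thorne method)] -/
theorem stub_crossLevelRaisingSeed :
    ∀ (p : ℕ) [Fact p.Prime], p ≠ 2 → ∀ (k : Type) [Field k] [CharP k p] [IsAlgClosed k] [TopologicalSpace k] [DiscreteTopology k] (red : Valued.integer (PadicAlgCl p) →+* k) (σ σ' : Literature.NumberTheory.GaloisRepresentations.FramedGaloisRep ℚ k 2) (hcpt : Literature.NumberTheory.Automorphic.isCompact_glFiniteIntegralLevel 4 ℚ) (ι : PadicAlgCl p ≃+* ℂ) (ρ₀ : Literature.NumberTheory.GaloisRepresentations.FramedGaloisRep ℚ (PadicAlgCl p) 4), σ.toGaloisRep.IsIrreducible → σ'.toGaloisRep.IsIrreducible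 → Summit.Langlands.Langlands.Cruxes.ResiduallyYoshidaLifting.CrossRegularAnnihilatorPrimes.DetCond p σ σ' → (¬ ∃ g : GL (Fin 2) k, ∀ x, g * σ x * g⁻¹ = σ' x) → ρ₀.toGaloisRep.IsIrreducible → Summit.Langlands.Langlands.Cruxes.ResiduallyYoshidaLifting.CrossRegularAnnihilatorPrimes.Sh σ σ' red ρ₀ → Summit.Langlands.Langlands.Cruxes.ResiduallyYoshidaLifting.CrossRegularAnnihilatorPrimes.Aut hcpt ι ρ₀ → ∃ (𝔫₀ : Ideal (NumberField.RingOfIntegers ℚ)) (T₀ : Literature.NumberTheory.Automorphic.InfinityType ℚ 4), 𝔫₀ ≠ 0 ∧ ∀ Q : Finset (IsDedekindDomain.HeightOneSpectrum (NumberField.RingOfIntegers ℚ)), (∀ v ∈ Q, Summit.Langlands.Langlands.Cruxes.ResiduallyYoshidaLifting.CrossRegularAnnihilatorPrimes.QGoodRes σ σ' 𝔫₀ ρ₀ v) → ∃ (π₁ : Literature.NumberTheory.Automorphic.CuspidalAutomorphicRepData 4 ℚ hcpt) (ρ₁ : Literature.NumberTheory.GaloisRepresentations.FramedGaloisRep ℚ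 (PadicAlgCl p) 4), Summit.Langlands.Langlands.Cruxes.ResiduallyYoshidaLifting.CrossRegularAnnihilatorPrimes.Member σ σ' red ι (𝔫₀ * Q.prod (fun v => v.asIdeal ^ 2)) T₀ π₁ ρ₁ ∧ ∀ v ∈ Q, Summit.Langlands.Langlands.Cruxes.ResiduallyYoshidaLifting.CrossRegularAnnihilatorPrimes.CrossType v ρ₁ := by
  sorry

/-- STUB S4 — THE LEVER, HARDEST (RESHAPED by the lead 2026-08-16 per Disproof T6b `CR.S4Seeded`: the seed's base level `𝔫₀`
and infinity type `T₀` are INPUTS, fixed before the ×-family level `𝔫₁` is chosen — no level-lowering of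
arbitrary-level seeds is hidden inside the stub; the registered planner form implies this one, `CR.s4Seeded_of_s4`) (integral `R_𝒮(N) = T_𝒮(N)` with the ×-type condition at the auxiliary primes, in
weight (2,2), read as a Hecke-span congruence `Summit.Langlands.Langlands.Cruxes.ResiduallyYoshidaLifting.CrossRegularAnnihilatorPrimes.HSC`). For `ρ` irreducible of shape `Sh` there are a level
`𝔫₁ ≠ 0` and an infinity type `T₁` such that for every `N` and every set `Q`, `#Q ≥ 2`, of admissible places of
depth `N` (`Summit.Langlands.Langlands.Cruxes.ResiduallyYoshidaLifting.CrossRegularAnnihilatorPrimes.QGood`: `v ∤ p𝔫₁`, `ρ` unramified, `ρ̄(Frob_v)` cross-regular generic, `ρ(Frob_v)` ×-congruent mod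
`p^N`): IF a stable automorphic ×-type point with the same residual pair exists at the primes of `Q` (S3's
seed, any base level prime to `Q`), THEN `ρ mod p^N` is an `𝒪/p^N`-point of the ×-new weight-2 Hecke algebra
of level `𝔫₁·Kl(Q)`: a finite family of cuspidal L-algebraic `GL₄` representations of level `K(𝔫₁∏_Q v²)`, type
`T₁`, with irreducible Galois representations of shape `Sh` and ×-type at `Q`, to which `ρ` is Hecke-span
congruent mod `p^N` (`Summit.Langlands.Langlands.Cruxes.ResiduallyYoshidaLifting.CrossRegularAnnihilatorPrimes.CrossFamily`). Inside (the card's lever): `ad⁰ρ̄ = ad⁰σ̄ ⊕ ad⁰σ̄' ⊕ M`; the ×-type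
local condition `𝒟_v^×` is Weil–Deligne-admissible (`cross ∈ 𝔰𝔭₄`, `cross² = 0`: triage r1-1 Scratch.lean,
proved), formally smooth and NEUTRAL (`dim L_v = 2 = h⁰(ℚ_v, ad⁰ρ̄)`), and `L_v^⊥` kills the
Taylor–Wiles-invisible classes of `H¹(ℚ, M(1))` seen by `Frob_v` (Thorne2016 Lemma 5.18 / Prop. 5.20 with
`St(α_v) ↦ 𝒟^×`, `M₁(1) ↦ M(1)`); reducible ×-type deformations are unramified at `v` with the exact cross
congruence, so with `#Q ≥ 2` the Yoshida locus is no component; ordinary Taylor–Wiles primes for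
`ad⁰σ̄(1) ⊕ ad⁰σ̄'(1)`; Calegari–Geraghty / BoxerEtAl2021 §7 patching of the weight-(2,2) higher-Hida 2-term
complexes (ℓ₀ = 1) with `R_∞` REGULAR (all local conditions smooth — triage r1-2 (ii)), which is what makes the
statement INTEGRAL; solvable base change / Ihara avoidance to move the seed onto `ρ`'s local components.
Honours `not_withoutIrreducibleρ_of_witness`: `ρ` irreducible is a hypothesis (for `ρ_f ⊕ ρ_g` this stub with
S2, S5 would contradict Jacquet–Shalika). [cite: Thorne2016, Cor. 5.11, Prop. 5.20, §6]
[cite: BoxerEtAl2021, §7] [cite: Kisin2009, (framed patching)] [cite: CalegariGeraghty2017, (ℓ₀ = 1)] -/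
theorem stub_crossTypePatching :
    ∀ (p : ℕ) [Fact p.Prime], p ≠ 2 → ∀ (k : Type) [Field k] [CharP k p] [IsAlgClosed k] [TopologicalSpace k] [DiscreteTopology k] (red : Valued.integer (PadicAlgCl p) →+* k) (σ σ' : Literature.NumberTheory.GaloisRepresentations.FramedGaloisRep ℚ k 2) (hcpt : Literature.NumberTheory.Automorphic.isCompact_glFiniteIntegralLevel 4 ℚ) (ι : PadicAlgCl p ≃+* ℂ) (ρ : Literature.NumberTheory.GaloisRepresentations.FramedGaloisRep ℚ (PadicAlgCl p) 4), σ.toGaloisRep.IsIrreducible → σ'.toGaloisRep.IsIrreducible → Summit.Langlands.Langlands.Cruxes.ResiduallyYoshidaLifting.CrossRegularAnnihilatorPrimes.DetCond p σ σ' → (¬ ∃ g : GL (Fin 2) k, ∀ x, g * σ x * g⁻¹ = σ' x) → ρ.toGaloisRep.IsIrreducible → Summit.Langlands.Langlands.Cruxes.ResiduallyYoshidaLifting.CrossRegularAnnihilatorPrimes.Sh σ σ' red ρ → ∀ (𝔫₀ : Ideal (NumberField.RingOfIntegers ℚ)) (T₀ : Literature.NumberTheory.Automorphic.InfinityType ℚ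 4), 𝔫₀ ≠ 0 → ∃ (𝔫₁ : Ideal (NumberField.RingOfIntegers ℚ)) (T₁ : Literature.NumberTheory.Automorphic.InfinityType ℚ 4), 𝔫₁ ≠ 0 ∧ ∀ (N : ℕ) (Q : Finset (IsDedekindDomain.HeightOneSpectrum (NumberField.RingOfIntegers ℚ))), (∀ v ∈ Q, Summit.Langlands.Langlands.Cruxes.ResiduallyYoshidaLifting.CrossRegularAnnihilatorPrimes.QGood σ σ' red 𝔫₁ ρ N v) → 2 ≤ Q.card → (∃ (π₁ : Literature.NumberTheory.Automorphic.CuspidalAutomorphicRepData 4 ℚ hcpt) (ρ₁ : Literature.NumberTheory.GaloisRepresentations.FramedGaloisRep ℚ (PadicAlgCl p) 4), (∀ v ∈ Q, ¬ (v.asIdeal ∣ 𝔫₀)) ∧ Summit.Langlands.Langlands.Cruxes.ResiduallyYoshidaLifting.CrossRegularAnnihilatorPrimes.Member σ σ' red ι (𝔫₀ * Q.prod (fun v => v.asIdeal ^ 2)) T₀ π₁ ρ₁ ∧ ∀ v ∈ Q, Summit.Langlands.Langlands.Cruxes.ResiduallyYoshidaLifting.CrossRegularAnnihilatorPrimes.CrossType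 v ρ₁) → Summit.Langlands.Langlands.Cruxes.ResiduallyYoshidaLifting.CrossRegularAnnihilatorPrimes.CrossFamily σ σ' red hcpt ι 𝔫₁ T₁ Q N ρ := by
  sorry

/-! ### STUB S5, RESHAPED by the lead (rev 2, 2026-08-16) into S5a + S5b + S5c with the glue
`successiveApproximation_of_stubs` (= the planner's S5 verbatim).  S5a isolates the OPEN automorphic input
(Mazur's principle / level lowering mod `p^N` at a residually-Yoshida `𝔪` in weight (2,2)); S5c isolates the
Harish-Chandra-finiteness input (a finite trace catalogue of the members of fixed level and infinity type);
S5b — the limit `N → ∞` against a finite catalogue — is pure `p`-adic analysis + Chebotarev and is provable now. -/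

/-- STUB S5a (Mazur's principle mod `p^N` at the auxiliary ×-primes — THE OPEN AUTOMORPHIC INPUT of S5).  If
`ρ mod p^N` is Hecke-span congruent to a ×-type family of level `K(𝔫₁∏_Q v²)` and type `T₁`
(`Summit.Langlands.Langlands.Cruxes.ResiduallyYoshidaLifting.CrossRegularAnnihilatorPrimes.CrossFamily`) at admissible auxiliary places `Q` of depth `N` (`Summit.Langlands.Langlands.Cruxes.ResiduallyYoshidaLifting.CrossRegularAnnihilatorPrimes.QGood`: `ρ` unramified at `v`, residually cross-regular
generic, ×-congruent mod `p^N`), then `ρ mod p^N` is already Hecke-span congruent to finitely many members of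
level `K(𝔫₁)` and type `T₁` (`Summit.Langlands.Langlands.Cruxes.ResiduallyYoshidaLifting.CrossRegularAnnihilatorPrimes.Member`, `Summit.Langlands.Langlands.Cruxes.ResiduallyYoshidaLifting.CrossRegularAnnihilatorPrimes.HSC`).  Thorne2016 Thm. 4.14 / Prop. 4.16 (GL₂, `𝔪` non-Eisenstein) and van Hoften
arXiv:1906.04008 Thm. 1.2 (GSp₄, `ρ̄` irreducible, regular weight, mod `ℓ`) are the nearest printed
statements; nothing covers a residually reducible `𝔪` in weight (2,2). OPEN IN PRINT.
[cite: Thorne2016, Thm. 4.14 and Prop. 4.16] -/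
theorem stub_mazurPrincipleModPN :
    ∀ (p : ℕ) [Fact p.Prime], p ≠ 2 → ∀ (k : Type) [Field k] [CharP k p] [IsAlgClosed k] [TopologicalSpace k] [DiscreteTopology k] (red : Valued.integer (PadicAlgCl p) →+* k) (σ σ' : Literature.NumberTheory.GaloisRepresentations.FramedGaloisRep ℚ k 2) (hcpt : Literature.NumberTheory.Automorphic.isCompact_glFiniteIntegralLevel 4 ℚ) (ι : PadicAlgCl p ≃+* ℂ) (ρ : Literature.NumberTheory.GaloisRepresentations.FramedGaloisRep ℚ (PadicAlgCl p) 4), σ.toGaloisRep.IsIrreducible → σ'.toGaloisRep.IsIrreducible → Summit.Langlands.Langlands.Cruxes.ResiduallyYoshidaLifting.CrossRegularAnnihilatorPrimes.DetCond p σ σ' → (¬ ∃ g : GL (Fin 2) k, ∀ x, g * σ x * g⁻¹ = σ' x) → ρ.toGaloisRep.IsIrreducible → Summit.Langlands.Langlands.Cruxes.ResiduallyYoshidaLifting.CrossRegularAnnihilatorPrimes.Sh σ σ' red ρ → ∀ (𝔫₁ : Ideal (NumberField.RingOfIntegers ℚ)) (T₁ : Literature.NumberTheory.Automorphic.InfinityType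 ℚ 4), 𝔫₁ ≠ 0 → ∀ (N : ℕ) (Q : Finset (IsDedekindDomain.HeightOneSpectrum (NumberField.RingOfIntegers ℚ))), (∀ v ∈ Q, Summit.Langlands.Langlands.Cruxes.ResiduallyYoshidaLifting.CrossRegularAnnihilatorPrimes.QGood σ σ' red 𝔫₁ ρ N v) → Summit.Langlands.Langlands.Cruxes.ResiduallyYoshidaLifting.CrossRegularAnnihilatorPrimes.CrossFamily σ σ' red hcpt ι 𝔫₁ T₁ Q N ρ → ∃ (r : ℕ) (πf : Fin r → Literature.NumberTheory.Automorphic.CuspidalAutomorphicRepData 4 ℚ hcpt) (ρf : Fin r → Literature.NumberTheory.GaloisRepresentations.FramedGaloisRep ℚ (PadicAlgCl p) 4), (∀ i, Summit.Langlands.Langlands.Cruxes.ResiduallyYoshidaLifting.CrossRegularAnnihilatorPrimes.Member σ σ' red ι 𝔫₁ T₁ (πf i) (ρf i)) ∧ Summit.Langlands.Langlands.Cruxes.ResiduallyYoshidaLifting.CrossRegularAnnihilatorPrimes.HSC N r ρf ρ := by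
  sorry

-- STUB S5b `stub_limitAtFixedLevel` LANDED (p99507, Theorems/…LimitAtFixedLevel.lean) and is imported.

/-- STUB S5c′ (rev 3; the AUTOMORPHIC FINITENESS BRIDGE `H_fin` — what is left of S5c after the landed p99281 and
`frobCatalogue_of_finiteCuspidal`): the cuspidal automorphic representations of `GL₄(𝔸_ℚ)` with a `K(𝔫₁)`-fixed vector
in `W ∖ W'` and infinity type `T₁` fall into finitely many near-equivalence classes.  Harish-Chandra finiteness in
representation form (Borel–Jacquet 1979, 4.3 (i)); the tree PROVES the automorphic-forms version
`harishChandra_finiteness_gl_holds` — the missing bridge is the control of `K_∞`-types by the infinity type and the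
finiteness of Hecke eigensystems on a finite-dimensional space (lead census `What is missing`).
[cite: BorelJacquet1979, 4.3 (i)] -/
theorem stub_finiteCuspidalSpectrum :
    ∀ (p : ℕ) [Fact p.Prime], p ≠ 2 → ∀ (k : Type) [Field k] [CharP k p] [IsAlgClosed k] [TopologicalSpace k] [DiscreteTopology k] (red : Valued.integer (PadicAlgCl p) →+* k) (σ σ' : Literature.NumberTheory.GaloisRepresentations.FramedGaloisRep ℚ k 2) (hcpt : Literature.NumberTheory.Automorphic.isCompact_glFiniteIntegralLevel 4 ℚ) (ι : PadicAlgCl p ≃+* ℂ) (𝔫₁ : Ideal (NumberField.RingOfIntegers ℚ)) (T₁ : Literature.NumberTheory.Automorphic.InfinityType ℚ 4), 𝔫₁ ≠ 0 → ∃ (s : ℕ) (πc : Fin s → Literature.NumberTheory.Automorphic.CuspidalAutomorphicRepData 4 ℚ hcpt), ∀ π : Literature.NumberTheory.Automorphic.CuspidalAutomorphicRepData 4 ℚ hcpt, π.1.HasInfinityType T₁ → (∃ φ ∈ π.1.W, φ ∉ π.1.W' ∧ ∀ u ∈ Literature.NumberTheory.Automorphic.principalCongruenceLevel 4 ℚ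 𝔫₁, Literature.NumberTheory.Automorphic.rightTranslation (Literature.NumberTheory.Automorphic.AdelicGroupData.gl 4 ℚ) u φ = φ) → ∃ j, π.1.IsNearlyEquivalent (πc j).1 := by
  sorry

/-- STUB S5c (finite TRACE catalogue of the members of fixed level and infinity type) — now a THEOREM from S5c′:
`frobCatalogue_of_finiteCuspidal` (landed: `H_fin` ⇒ Frobenius-a.e. catalogue, Satake uniqueness) and
`stub_traceCatalogue_of_frobCatalogue` (landed p99281: Frobenius-a.e. catalogue ⇒ trace catalogue, Chebotarev +
continuity).  Statement = the registered S5c verbatim. [cite: BorelJacquet1979, 4.3 (i) (Harish-Chandra finiteness)] -/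
theorem stub_traceCatalogue :
    ∀ (p : ℕ) [Fact p.Prime], p ≠ 2 → ∀ (k : Type) [Field k] [CharP k p] [IsAlgClosed k] [TopologicalSpace k] [DiscreteTopology k] (red : Valued.integer (PadicAlgCl p) →+* k) (σ σ' : Literature.NumberTheory.GaloisRepresentations.FramedGaloisRep ℚ k 2) (hcpt : Literature.NumberTheory.Automorphic.isCompact_glFiniteIntegralLevel 4 ℚ) (ι : PadicAlgCl p ≃+* ℂ) (𝔫₁ : Ideal (NumberField.RingOfIntegers ℚ)) (T₁ : Literature.NumberTheory.Automorphic.InfinityType ℚ 4), 𝔫₁ ≠ 0 → ∃ (s : ℕ) (πc : Fin s → Literature.NumberTheory.Automorphic.CuspidalAutomorphicRepData 4 ℚ hcpt) (rc : Fin s → Literature.NumberTheory.GaloisRepresentations.FramedGaloisRep ℚ (PadicAlgCl p) 4), (∀ j, Summit.Langlands.Langlands.Cruxes.ResiduallyYoshidaLifting.CrossRegularAnnihilatorPrimes.Member σ σ' red ι 𝔫₁ T₁ (πc j) (rc j)) ∧ ∀ (π : Literature.NumberTheory.Automorphic.CuspidalAutomorphicRepData 4 ℚ hcpt) (r : Literature.NumberTheory.GaloisRepresentations.FramedGaloisRep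 ℚ (PadicAlgCl p) 4), Summit.Langlands.Langlands.Cruxes.ResiduallyYoshidaLifting.CrossRegularAnnihilatorPrimes.Member σ σ' red ι 𝔫₁ T₁ π r → ∃ j, ∀ g, (r g).val.charpoly = (rc j g).val.charpoly := by
  intro p _ hp k _ _ _ _ _ red σ σ' hcpt ι 𝔫₁ T₁ h𝔫₁
  exact stub_traceCatalogue_of_frobCatalogue p hp k red σ σ' hcpt ι 𝔫₁ T₁ h𝔫₁
    (frobCatalogue_of_finiteCuspidal p hp k red σ σ' hcpt ι 𝔫₁ T₁ h𝔫₁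
      (stub_finiteCuspidalSpectrum p hp k red σ σ' hcpt ι 𝔫₁ T₁ h𝔫₁))

/-- The planner's STUB S5 VERBATIM (automorphy by successive approximation), now a THEOREM from S5a, S5b, S5c:
Mazur's principle mod `p^N` moves each depth-`N` congruence to the fixed level `𝔫₁` (S5a), the members there
form a finite trace catalogue (S5c), and the limit against a finite catalogue is S5b.
[cite: Thorne2016, Cor. 4.15 and Thm. 4.14] -/
theorem successiveApproximation_of_stubs :
    ∀ (p : ℕ) [Fact p.Prime], p ≠ 2 → ∀ (k : Type) [Field k] [CharP k p] [IsAlgClosed k] [TopologicalSpace k] [DiscreteTopology k] (red : Valued.integer (PadicAlgCl p) →+* k) (σ σ' : Literature.NumberTheory.GaloisRepresentations.FramedGaloisRep ℚ k 2) (hcpt : Literature.NumberTheory.Automorphic.isCompact_glFiniteIntegralLevel 4 ℚ) (ι : PadicAlgCl p ≃+* ℂ) (ρ : Literature.NumberTheory.GaloisRepresentations.FramedGaloisRep ℚ (PadicAlgCl p) 4), σ.toGaloisRep.IsIrreducible → σ'.toGaloisRep.IsIrreducible → Summit.Langlands.Langlands.Cruxes.ResiduallyYoshidaLifting.CrossRegularAnnihilatorPrimes.DetCond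 p σ σ' → (¬ ∃ g : GL (Fin 2) k, ∀ x, g * σ x * g⁻¹ = σ' x) → ρ.toGaloisRep.IsIrreducible → Summit.Langlands.Langlands.Cruxes.ResiduallyYoshidaLifting.CrossRegularAnnihilatorPrimes.Sh σ σ' red ρ → ∀ (𝔫₁ : Ideal (NumberField.RingOfIntegers ℚ)) (T₁ : Literature.NumberTheory.Automorphic.InfinityType ℚ 4), 𝔫₁ ≠ 0 → (∀ N : ℕ, ∃ Q : Finset (IsDedekindDomain.HeightOneSpectrum (NumberField.RingOfIntegers ℚ)), (∀ v ∈ Q, Summit.Langlands.Langlands.Cruxes.ResiduallyYoshidaLifting.CrossRegularAnnihilatorPrimes.QGood σ σ' red 𝔫₁ ρ N v) ∧ Summit.Langlands.Langlands.Cruxes.ResiduallyYoshidaLifting.CrossRegularAnnihilatorPrimes.CrossFamily σ σ' red hcpt ι 𝔫₁ T₁ Q N ρ) → Summit.Langlands.Langlands.Cruxes.ResiduallyYoshidaLifting.CrossRegularAnnihilatorPrimes.Aut hcpt ι ρ := by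
  intro p _ hp k _ _ _ _ _ red σ σ' hcpt ι ρ hirr hirr' hdet hnc hirrρ hShρ 𝔫₁ T₁ h𝔫₁ hfam
  have hcat := stub_traceCatalogue p hp k red σ σ' hcpt ι 𝔫₁ T₁ h𝔫₁
  refine stub_limitAtFixedLevel p hp k red σ σ' hcpt ι ρ hShρ 𝔫₁ T₁ hcat fun N => ?_
  obtain ⟨Q, hQ, hCF⟩ := hfam N
  exact stub_mazurPrincipleModPN p hp k red σ σ' hcpt ι ρ hirr hirr' hdet hnc hirrρ hShρ 𝔫₁ T₁ h𝔫₁ N Q hQ hCF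


-- STUB S0 `stub_cruxUnfold` (definitional, `Iff.rfl`) LANDED with the currency module (p95988) and is imported.

/-! ## Composition: the stubs imply the crux

Pure logic over the five stubs: S1 gives the exact cross-regular element; S3 (applied to `ρ₀`) a base level
`𝔫₀` and type `T₀` with ×-type seeds at every residually admissible `Q`; S4 (applied to `ρ`) a level `𝔫₁` and
type `T₁`; for each depth `N`, S2 (avoiding `𝔫₀𝔫₁`, `#Q ≥ 2`) supplies `Q_N`, S3 the seed at `Q_N`, S4 the
×-family with `HSC N`; S5 concludes `Aut ρ`. The crux's inline `let εb / Aut / Sh` clauses are passed to the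
currency's `DetCond / Aut / Sh` by definitional unfolding; the only lemmas used are `mul_ne_zero`,
`dvd_mul_of_dvd_left`, `dvd_mul_of_dvd_right`. -/

/-- **The crux `ResiduallyYoshidaLifting` from the stubs of line `cross-regular-annihilator-primes`.**
[cite: Thorne2016, Cor. 4.15 (architecture of the argument)] -/
theorem ResiduallyYoshidaLifting_of :
    Summit.Langlands.Langlands.Theses.PhantomRMYoshida.ResiduallyYoshidaLifting := by
  refine stub_cruxUnfold.mpr ?_
  intro p _ hp k _ _ _ _ _ red σ σ' hcpt ι ρ₀ ρ hodd hodd' hirr hirr' hdet hnc hirr₀ hSh₀ hAut₀ hirrρ hShρ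
  -- S1: an exact cross-regular element in `im ρ`
  have hX := stub_exactCrossElement p hp k red σ σ' hcpt ι ρ hirr hirr' hdet hnc hirrρ hShρ
  -- S3: base level / infinity type of the seed and ×-type level raising of `ρ₀`
  obtain ⟨𝔫₀, T₀, h𝔫₀, hseed⟩ :=
    stub_crossLevelRaisingSeed p hp k red σ σ' hcpt ι ρ₀ hirr hirr' hdet hnc hirr₀ hSh₀ hAut₀
  -- S4 (seeded): level / infinity type of the ×-families GIVEN the seed level, and the patching statement for `ρ`
  obtain ⟨𝔫₁, T₁, h𝔫₁, hpatch⟩ :=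
    stub_crossTypePatching p hp k red σ σ' hcpt ι ρ hirr hirr' hdet hnc hirrρ hShρ 𝔫₀ T₀ h𝔫₀
  -- S5: successive approximation at level `𝔫₁`
  refine successiveApproximation_of_stubs p hp k red σ σ' hcpt ι ρ hirr hirr' hdet hnc hirrρ hShρ 𝔫₁ T₁ h𝔫₁ ?_
  intro N
  -- S2: auxiliary primes of depth `N`, prime to `𝔫₀ 𝔫₁`, at least two of them
  obtain ⟨Q, hcard, hQ⟩ := stub_crossRegularSupply p hp k red σ σ' hcpt ι ρ₀ ρ hSh₀ hShρ hX (𝔫₀ * 𝔫₁)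
    (mul_ne_zero h𝔫₀ h𝔫₁) 2 N
  refine ⟨Q, fun v hv => ?_, ?_⟩
  · -- admissibility of `v ∈ Q` relative to `𝔫₁` (for S4 / S5)
    obtain ⟨hρ₀v, hdvd, hvp, hρv, hσv, hσ'v, a, b, hcongr, hres⟩ := hQ v hv
    exact ⟨fun h1 => hdvd (dvd_mul_of_dvd_right h1 𝔫₀), hvp, hρv, hσv, hσ'v, a, b, hcongr, hres⟩
  · -- the seed at `Q` (S3), then the ×-family with `HSC N` (S4)
    obtain ⟨π₁, ρ₁, hmem, hx₁⟩ := hseed Q (fun v hv => by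
      obtain ⟨hρ₀v, hdvd, hvp, hρv, hσv, hσ'v, a, b, hcongr, hres⟩ := hQ v hv
      exact ⟨fun h0 => hdvd (dvd_mul_of_dvd_left h0 𝔫₁), hvp, hρ₀v, hσv, hσ'v, red a, red b, hres⟩)
    exact hpatch N Q (fun v hv => by
      obtain ⟨hρ₀v, hdvd, hvp, hρv, hσv, hσ'v, a, b, hcongr, hres⟩ := hQ v hv
      exact ⟨fun h1 => hdvd (dvd_mul_of_dvd_right h1 𝔫₀), hvp, hρv, hσv, hσ'v, a, b, hcongr, hres⟩) hcard
      ⟨π₁, ρ₁, fun v hv => fun h0 => (hQ v hv).2.1 (dvd_mul_of_dvd_left h0 𝔫₁), hmem, hx₁⟩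

end Summit.Langlands.Langlands.Cruxes.ResiduallyYoshidaLifting.CrossRegularAnnihilatorPrimes

end
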